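import Summits.KontsevichZagierPeriods.KontsevichZagierPeriods.Theorems.HermiteRigidityReductionRigidityDupTowerTwoKernelGen
import Summits.KontsevichZagierPeriods.KontsevichZagierPeriods.Theorems.HermiteRigidityReductionRigidityDupJoinKernelGen
import Literature.NumberTheory.DiophantineApproximation.PolylogShiftFourPointsLinearIndependence

/-!
# `ReductionRigidity` (stmt-KontsevichZagierPeriods-3407), line `Sketch`: THE DUPLICATION TOWER OF HEIGHT TWO IS UNCONDITIONAL
# for `log N ≥ 64 (w+1)³` (`stub_dupTowerTwoKernelGenUnconditional`)

Route `KontsevichZagierPeriods/HermiteRigidity`, crux `ReductionRigidity` (stmt-3407, summit-equivalent). Lead seat c7, cycle 4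
(growth item G13). The five-level island `stub_dupTowerTwoKernelGen` (levels `N, −N, N², −N², N⁴`, rigidity of
`1, Li_s(1/N), Li_s(−1/N), Li_s(−1/N²)` inlined; proved by an in-session worker over the duplication moves) fed with the PROVED
rigidity `one_polylog_fourPoints_linearIndependent` (the case `m = 4` of the distinct-shifts Hermite–Padé programme
`PolylogShift*.lean`): Conjecture 1 of Kontsevich–Zagier in kernel form on the five-level box sector in all dimensions `≤ w`, with
NO hypothesis, for every `N` with `log N ≥ 64 (w+1)³`.

References: M. Kontsevich, D. Zagier, *Periods* (2001), §1.2 [cite: KontsevichZagier2001, §1.2]; S. David, N. Hirata-Kohno,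
M. Kawashima, Moscow J. Comb. Number Theory 9 (2020), Thm 2.1 [cite: DavidHirataKohnoKawashima2020, Thm 2.1]. No definitions.
-/

noncomputable section

open MeasureTheory Set MvPolynomial

namespace Summit.KontsevichZagierPeriods.HermiteRigidity.ReductionRigidity

open Literature.NumberTheory.Transcendental
open Literature.NumberTheory.Transcendental.KZ

/-- **Stub `stub_dupTowerTwoKernelGenUnconditional`**: THE DUPLICATION TOWER OF HEIGHT TWO `{N, −N, N², −N², N⁴}` in every
weight, UNCONDITIONAL for `w ≥ 1` and `log N ≥ 64(w+1)³` — `stub_dupTowerTwoKernelGen` over the proved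
`one_polylog_fourPoints_linearIndependent`, the cube values being `Li_i(±1/N)`, `Li_i(−1/N²)` by `stub_cubeIntegralSeriesLevel`
and `integral_cube_one_div_prod_absLevel`. [cite: KontsevichZagier2001, §1.2] [cite: DavidHirataKohnoKawashima2020, Thm 2.1] -/
theorem stub_dupTowerTwoKernelGenUnconditional : ∀ (w N : ℕ), 1 ≤ w → 64 * ((w : ℝ) + 1) ^ 3 ≤ Real.log N →
    ∀ c ∈ AddSubgroup.closure ({c | ∃ (j : ℕ) (r : IntegralRep j) (a : Fin j → ℕ) (m : ℕ), j ≤ w ∧ r.domain = cube j ∧ EqOn r.integrand (fun p => (∏ l, p l ^ a l) / ((N : ℝ) - ∏ l, p l) ^ m) (cube j) ∧ c = KZ.of r} ∪ {c | ∃ (j : ℕ) (r : IntegralRep j) (a : Fin j → ℕ) (m : ℕ), j ≤ w ∧ r.domain = cube j ∧ EqOn r.integrand (fun p => (∏ l, p l ^ a l) / ((-(N : ℝ)) - ∏ l, p l) ^ m) (cube j) ∧ c = KZ.of r} ∪ {c | ∃ (j : ℕ) (r : IntegralRep j) (a : Fin j → ℕ) (m : ℕ), j ≤ w ∧ r.domain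 = cube j ∧ EqOn r.integrand (fun p => (∏ l, p l ^ a l) / ((N : ℝ) ^ 2 - ∏ l, p l) ^ m) (cube j) ∧ c = KZ.of r} ∪ {c | ∃ (j : ℕ) (r : IntegralRep j) (a : Fin j → ℕ) (m : ℕ), j ≤ w ∧ r.domain = cube j ∧ EqOn r.integrand (fun p => (∏ l, p l ^ a l) / ((-((N : ℝ) ^ 2)) - ∏ l, p l) ^ m) (cube j) ∧ c = KZ.of r} ∪ {c | ∃ (j : ℕ) (r : IntegralRep j) (a : Fin j → ℕ) (m : ℕ), j ≤ w ∧ r.domain = cube j ∧ EqOn r.integrand (fun p => (∏ l, p l ^ a l) / ((N : ℝ) ^ 4 - ∏ l, p l) ^ m) (cube j) ∧ c = KZ.of r}), KZ.eval c = 0 → c ∈ KZ.relations := by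
  intro w N hw hlog
  have hw1 : (1 : ℝ) ≤ w := by exact_mod_cast hw
  have hL : (512 : ℝ) ≤ Real.log N := by
    have h2 : (2 : ℝ) ^ 3 ≤ ((w : ℝ) + 1) ^ 3 := pow_le_pow_left₀ (by norm_num) (by linarith only [hw1]) 3
    norm_num at h2
    linarith only [h2, hlog]
  have hN0 : (N : ℝ) ≠ 0 := by
    intro h0; rw [h0, Real.log_zero] at hL; linarith only [hL]
  have hNpos : (0 : ℝ) < N := lt_of_le_of_ne (Nat.cast_nonneg N) (Ne.symm hN0)
  have hNR : (2 : ℝ) ≤ N := by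
    have h1 : Real.log N ≤ (N : ℝ) - 1 := Real.log_le_sub_one_of_pos hNpos
    linarith only [h1, hL]
  have hN : 2 ≤ N := by exact_mod_cast hNR
  refine stub_dupTowerTwoKernelGen w N hN fun a b c d h => ?_
  have IP : ∀ i, (∫ p in cube (i + 1), 1 / ((N : ℝ) - ∏ l, p l)) =
      Literature.NumberTheory.DiophantineApproximation.DilogPade.polylogSeries (i + 1) (1 / (N : ℝ)) := fun i => by
    rw [stub_cubeIntegralSeriesLevel (i + 1) (N : ℝ) hNR,
      Literature.NumberTheory.DiophantineApproximation.DilogPade.polylogSeries]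
  have IM : ∀ i, (∫ p in cube (i + 1), 1 / ((-(N : ℝ)) - ∏ l, p l)) =
      Literature.NumberTheory.DiophantineApproximation.DilogPade.polylogSeries (i + 1) (-(1 / (N : ℝ))) := fun i => by
    rw [integral_cube_one_div_prod_absLevel (i + 1) (-(N : ℝ)) (by rw [abs_neg, Nat.abs_cast]; linarith only [hNR]),
      Literature.NumberTheory.DiophantineApproximation.DilogPade.polylogSeries]
    refine tsum_congr fun k => ?_
    rw [one_div_neg_eq_neg_one_div]
  have IM2 : ∀ i, (∫ p in cube (i + 1), 1 / ((-((N : ℝ) ^ 2)) - ∏ l, p l)) =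
      Literature.NumberTheory.DiophantineApproximation.DilogPade.polylogSeries (i + 1) (-(1 / (N : ℝ) ^ 2)) := fun i => by
    have hab : 1 < |(-((N : ℝ) ^ 2))| := by
      rw [abs_neg, abs_of_nonneg (by positivity)]; nlinarith [hNR]
    rw [integral_cube_one_div_prod_absLevel (i + 1) (-((N : ℝ) ^ 2)) hab,
      Literature.NumberTheory.DiophantineApproximation.DilogPade.polylogSeries]
    refine tsum_congr fun k => ?_
    rw [one_div_neg_eq_neg_one_div]
  simp_rw [IP, IM, IM2] at h
  have key := Literature.NumberTheory.DiophantineApproximation.one_polylog_fourPoints_linearIndependent w hw N hlog a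
    (fun j : Fin w => b j) (fun j : Fin w => c j) (fun j : Fin w => d j) (by
      rw [Finset.sum_range (fun i => (b i : ℝ) *
          Literature.NumberTheory.DiophantineApproximation.DilogPade.polylogSeries (i + 1) (1 / (N : ℝ))),
        Finset.sum_range (fun i => (c i : ℝ) *
          Literature.NumberTheory.DiophantineApproximation.DilogPade.polylogSeries (i + 1) (-(1 / (N : ℝ)))),
        Finset.sum_range (fun i => (d i : ℝ) *
          Literature.NumberTheory.DiophantineApproximation.DilogPade.polylogSeries (i + 1) (-(1 / (N : ℝ) ^ 2)))] at h
      exact h)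
  obtain ⟨ha, hb, hc, hd⟩ := key
  refine ⟨ha, fun i hi => ?_, fun i hi => ?_, fun i hi => ?_⟩
  · have := congrFun hb ⟨i, Finset.mem_range.1 hi⟩
    simpa using this
  · have := congrFun hc ⟨i, Finset.mem_range.1 hi⟩
    simpa using this
  · have := congrFun hd ⟨i, Finset.mem_range.1 hi⟩
    simpa using this

end Summit.KontsevichZagierPeriods.HermiteRigidity.ReductionRigidity

end
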